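import Literature.AlgebraicGeometry.HodgeTheory.HodgeConjectureProductsOddHypersurfacesSupportedMiddle
import Literature.AlgebraicGeometry.HodgeTheory.BettiHodgeConjectureProductsReducedKunnethPieces
import Literature.AlgebraicGeometry.HodgeTheory.GeneralHodgePropertyOfSmallChowGroup
import Literature.AlgebraicGeometry.HodgeTheory.BettiHodgeGroupTrivialPureTypeDegrees
import Literature.AlgebraicGeometry.HodgeTheory.BettiIrregularityHodgeTateType
import HarnessLib

/-!
# `HC(T × T')` for two smooth projective threefolds with `CH₀ ⊗ ℚ = ℚ` (rationally connected threefolds,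
# Fano threefolds, …) — unconditionally (Bloch–Srinivas 1983; Voisin I §11.3.3; Voisin 2013 Lemma 2.1)

Family `hodge`, layer `Literature/AlgebraicGeometry/HodgeTheory`; sequel of
`HodgeConjectureProductsOddHypersurfacesSupportedMiddle` (the hypersurface case), written for the cell
`hodge-nonav` (memo ROUTE-P3v20, LEMMA AB). THEOREMS ONLY: no definition, no named fact, no instance
(D-0026 net debt `0`); every input is a theorem of the tree.

THE ARGUMENT. For a smooth projective complex threefold `T` with `dim_ℚ CH₀(T) ⊗ ℚ ≤ 1`
(`Motives.ChowRankLEOneUpTo T 0`), Bloch–Srinivas' decomposition of the diagonal — PROVED on the tree's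
carriers — gives `h^{1,0} = h^{2,0} = h^{3,0} = 0` (`BettiUniverse.hodgeNumber_eq_zero_of_chowRankLEOneUpTo_zero`)
and `N¹ H³(T(ℂ); ℂ) = H³(T(ℂ); ℂ)` (`supportedClasses_eq_top_of_chowRankLEOneUpTo_zero`). For two such threefolds
the lane `lit-hodgefound`'s reduction `BettiUniverse.hodgeConjectureFor_tensor_threefolds_of_kunneth_pieces`
(`HC(T × T')` ⟸ algebraicity of the Hodge classes of the Künneth pieces `H¹⊗H³`, `H²⊗H²`, `H³⊗H¹` of `H⁴` and
`H³⊗H³` of `H⁶`; `HC` in dimension `3` is the tree's `hodgeConjectureFor_of_dim_le_three_holds`) leaves: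
`H¹ ⊗ H³`, `H³ ⊗ H¹` — zero (`q = 0`); `H² ⊗ H²` — both factors of pure type `(1,1)`, so its Hodge classes are
spanned by products of divisor classes (Lefschetz `(1,1)`; the tree's
`BettiUniverse.ofRatClass_crossMap_mem_algebraicClasses_of_hodgeClasses_eq_top_right`); and `H³ ⊗ H³` — supported
in codimension `2` on the sixfold since both factors are supported on divisors, hence its rational `(3,3)`-classes
are algebraic by Voisin 2013 Lemma 2.1 (Deligne 8.2.8 + lifting of Hodge classes along Gysin surjections +
Lefschetz `(1,1)`), the tree's `BettiUniverse.ofRatClass_crossMap_mem_algebraicClasses_of_supportedClasses_eq_top`.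

WHAT IS PROVED.
* `BettiUniverse.hodgeConjectureFor_tensor_threefolds_of_q_zero_of_h20_zero_of_supportedClasses_three_eq_top` —
  the Hodge-theoretic core: `q(T) = q(T') = 0`, `h^{2,0}(T') = 0` and `N¹H³ = H³` on both factors ⇒ `HC(T × T')`.
* **`hodgeConjectureFor_tensor_threefolds_of_chowRankLEOneUpTo_zero`** — `HC(T × T')` for any two smooth
  projective complex threefolds with `CH₀ ⊗ ℚ` of rank `≤ 1`, UNCONDITIONALLY; Chow-group form
  `hodgeConjectureFor_tensor_threefolds_of_chowGroup_zero_rank_le_one`.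

DEVIATIONS / SCOPE. The statements are the standard consequences of Bloch–Srinivas for threefolds with small
`CH₀` assembled on the tree's carriers, not verbatim theorems in print (nearest: Bloch–Srinivas 1983 Thm. 1,
Conte–Murre 1978, Laterveer 1998 / Vial 2013 Thm. 7.1 for ONE variety with small Chow groups). Rational
connectedness ⇒ `CH₀ = ℤ` is not restated here (the tree's `Motives.KollarMiyaokaMori1992_fano_rationallyChainConnected`
is a named fact; hypersurface threefolds of degree `≤ 4` are covered unconditionally by the sister file).

## References
* [BlochSrinivas1983] S. Bloch, V. Srinivas, *Remarks on correspondences and algebraic cycles*, Amer. J. Math. 105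
  (1983) — Thm. 1.
* [VoisinHodgeI2002] C. Voisin, *Hodge Theory and Complex Algebraic Geometry I* — §11.3.3 Thm. 11.38, Thm. 11.40,
  Lemma 11.41, p. 287; §11.3.1 Thm. 11.30; §6.2.3 Thm. 6.25.
* [VoisinHodgeII2003] C. Voisin, *Hodge Theory and Complex Algebraic Geometry II* — §10.2.2 Thm. 10.17, Cor. 10.18;
  §10.3.1 Thm. 10.31.
* [Voisin2013GHCBloch] C. Voisin, Ann. Sci. ÉNS 46 (2013) — Lemma 2.1 (proof).
* [Voisin2025] C. Voisin, J. Open Math. Probl. 1 (2025) — Cor. 2.12, §5.2 Thm. 5.6 / Cor. 5.7.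
* [Vial2013] Ch. Vial, Doc. Math. 18 (2013) — Thm. 7.1 (i).

## Provenance
Cell `hodge-nonav` (summit `HodgeConjecture`, rung F-H1), seat `littype-FH1-2` (literature-prover, generation 17).
-/

noncomputable section

open scoped TensorProduct
open CategoryTheory AlgebraicGeometry MonoidalCategory CartesianMonoidalCategory Module Finset
open Literature.AlgebraicTopology.SingularHomology
open Literature.Geometry.Kaehler

namespace Literature.AlgebraicGeometry.HodgeTheory

open Literature.AlgebraicGeometry.Motives
open Literature.AlgebraicGeometry.Motives.HodgeStructure

variable {T T' : SchemeOver ℂ}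

section Hodge

variable [HodgeTensorFacts.{0, 0}]

/-- **`HC(T × T')` for two smooth projective threefolds with `q(T) = q(T') = 0`, `h^{2,0}(T') = 0` and
`N¹H³ = H³` on both** (middle cohomology supported on a divisor): the pieces `H¹⊗H³`, `H³⊗H¹` vanish, the Hodge
classes of `H²⊗H²` are products of divisor classes (`H²(T')` being of pure type `(1,1)`, Lefschetz `(1,1)` on both
factors), and the Hodge classes of `H³⊗H³ ⊂ N²H⁶(T × T')` are algebraic by Voisin 2013 Lemma 2.1.
[cite: VoisinHodgeI2002, §11.3.3 Thm. 11.38, Lemma 11.41 and p. 287] [cite: Voisin2013GHCBloch, Lemma 2.1 (proof)]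
[cite: BlochSrinivas1983, Thm. 1] -/
theorem BettiUniverse.hodgeConjectureFor_tensor_threefolds_of_q_zero_of_h20_zero_of_supportedClasses_three_eq_top
    (hHD : exists_isReal_hodgeModel) (hT : IsSmoothProjective 3 T) (hT' : IsSmoothProjective 3 T')
    (hq : (BettiUniverse.hodge hHD hT 1).hodgeNumber 1 0 = 0) (hq' : (BettiUniverse.hodge hHD hT' 1).hodgeNumber 1 0 = 0)
    (h20' : (BettiUniverse.hodge hHD hT' 2).hodgeNumber 2 0 = 0)
    (h3 : supportedClasses T 3 1 = ⊤) (h3' : supportedClasses T' 3 1 = ⊤) :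
    HodgeConjectureFor (3 + 3) (T ⊗ T') := by
  have hTT' : IsSmoothProjective 6 (T ⊗ T') := hT.tensor_holds hT'
  have hb1 : Module.finrank ℚ (bettiCohomology T 1) = 0 :=
    (BettiUniverse.finrank_bettiCohomology_one_eq_zero_iff hHD hT).2 hq
  have hb1' : Module.finrank ℚ (bettiCohomology T' 1) = 0 :=
    (BettiUniverse.finrank_bettiCohomology_one_eq_zero_iff hHD hT').2 hq'
  have hHC : HodgeConjectureFor 3 T := hodgeConjectureFor_of_dim_le_three_holds le_rfl hT
  have hHC' : HodgeConjectureFor 3 T' := hodgeConjectureFor_of_dim_le_three_holds le_rfl hT'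
  -- Hodge classes of `T` are algebraic (dimension `3`), all of `H²(T')` is algebraic (`h^{2,0}(T') = 0`)
  have halgT : ∀ (p : ℕ), ∀ z ∈ (BettiUniverse.hodge hHD hT (2 * p)).hodgeClasses (p : ℤ),
      ofRatClass (ComplexPoints T) (2 * p) z ∈ algebraicClasses T p :=
    fun p z hz ↦ hHC.2 p _ (isRationalClass_ofRatClass _) ((BettiUniverse.mem_hodgeClasses_hodge_iff_isOfHodgeType hHD hT p z).1 hz)
  have htop' : (BettiUniverse.hodge hHD hT' (2 * 1)).hodgeClasses (1 : ℕ) = ⊤ :=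
    (BettiUniverse.hodgeClasses_hodge_two_eq_top_iff hHD hT').2 h20'
  have halgT'2 : ∀ w : bettiCohomology T' (2 * 1), ofRatClass (ComplexPoints T') (2 * 1) w ∈ algebraicClasses T' 1 :=
    fun w ↦ hHC'.2 1 _ (isRationalClass_ofRatClass _)
      ((BettiUniverse.mem_hodgeClasses_hodge_iff_isOfHodgeType hHD hT' 1 w).1 (by rw [htop']; exact Submodule.mem_top))
  refine BettiUniverse.hodgeConjectureFor_tensor_threefolds_of_kunneth_pieces hHD hT hT' hTT' ?_ ?_ ?_ ?_
  · -- `H¹(T) ⊗ H³(T')`: `H¹(T) = 0`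
    intro t _
    exact BettiUniverse.ofRatClass_crossMap_mem_algebraicClasses_of_finrank_eq_zero hT hT' _ (Or.inl hb1) t
  · -- `H²(T) ⊗ H²(T')`: products of divisor classes
    intro t ht
    exact BettiUniverse.ofRatClass_crossMap_mem_algebraicClasses_of_hodgeClasses_eq_top_right hHD hT hT'
      (a := 1) (b := 1) (c := 2) (by norm_num) htop' (halgT 1) halgT'2 ht
  · -- `H³(T) ⊗ H¹(T')`: `H¹(T') = 0`
    intro t _
    exact BettiUniverse.ofRatClass_crossMap_mem_algebraicClasses_of_finrank_eq_zero hT hT' _ (Or.inr hb1') t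
  · -- `H³(T) ⊗ H³(T')`: supported in codimension `2`, Voisin 2013 Lemma 2.1
    intro t ht
    exact BettiUniverse.ofRatClass_crossMap_mem_algebraicClasses_of_supportedClasses_eq_top hHD hT hT' hTT'
      (i := 3) (j := 3) (p := 2) (r := 1) (s := 1) (by norm_num) (by norm_num) h3 h3' ht

end Hodge

/-- **`HC(T × T')` for any two smooth projective complex threefolds whose `CH₀ ⊗ ℚ` has rank `≤ 1`**
(`Motives.ChowRankLEOneUpTo _ 0`; e.g. rationally connected threefolds, Fano threefolds) — UNCONDITIONALLY:
Bloch–Srinivas gives `h^{1,0} = h^{2,0} = 0` and `N¹H³ = H³` on both factors (the tree's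
`BettiUniverse.hodgeNumber_eq_zero_of_chowRankLEOneUpTo_zero`, `supportedClasses_eq_top_of_chowRankLEOneUpTo_zero`),
and the previous theorem applies; the standing tensor facts and the real Hodge model are theorems of the tree.
[cite: BlochSrinivas1983, Thm. 1] [cite: VoisinHodgeII2003, §10.2.2 Thm. 10.17 and Cor. 10.18]
[cite: Voisin2013GHCBloch, Lemma 2.1 (proof)] [cite: VoisinHodgeI2002, §11.3.3 Thm. 11.38, Lemma 11.41 and p. 287] -/
theorem hodgeConjectureFor_tensor_threefolds_of_chowRankLEOneUpTo_zero (hT : IsSmoothProjective 3 T)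
    (hT' : IsSmoothProjective 3 T') (hCH : ChowRankLEOneUpTo T 0) (hCH' : ChowRankLEOneUpTo T' 0) :
    HodgeConjectureFor (3 + 3) (T ⊗ T') := by
  haveI : HodgeTensorFacts.{0, 0} := hodgeTensorFacts_holds
  have hq := (BettiUniverse.hodgeNumber_eq_zero_of_chowRankLEOneUpTo_zero exists_isReal_hodgeModel_holds hT hCH
    (k := 1) le_rfl).2
  have hq' := (BettiUniverse.hodgeNumber_eq_zero_of_chowRankLEOneUpTo_zero exists_isReal_hodgeModel_holds hT' hCH'
    (k := 1) le_rfl).2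
  have h20' := (BettiUniverse.hodgeNumber_eq_zero_of_chowRankLEOneUpTo_zero exists_isReal_hodgeModel_holds hT' hCH'
    (k := 2) (by norm_num)).2
  exact BettiUniverse.hodgeConjectureFor_tensor_threefolds_of_q_zero_of_h20_zero_of_supportedClasses_three_eq_top
    exists_isReal_hodgeModel_holds hT hT' (by simpa using hq) (by simpa using hq') (by simpa using h20') (supportedClasses_eq_top_of_chowRankLEOneUpTo_zero hT hCH (k := 3) (by norm_num))
    (supportedClasses_eq_top_of_chowRankLEOneUpTo_zero hT' hCH' (k := 3) (by norm_num))

/-- The same with the hypothesis on the Chow GROUPS `CH₀ = Z₀/Rat₀` (`Motives.ChowGroup`): **if any two classes of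
`CH₀(T)` and any two classes of `CH₀(T')` are `ℤ`-linearly dependent (`CH₀ ⊗ ℚ` of rank `≤ 1`), then `HC(T × T')`**.
[cite: BlochSrinivas1983, Thm. 1] [cite: Voisin2013GHCBloch, Lemma 2.1 (proof)] -/
theorem hodgeConjectureFor_tensor_threefolds_of_chowGroup_zero_rank_le_one (hT : IsSmoothProjective 3 T)
    (hT' : IsSmoothProjective 3 T')
    (hCH : ∀ a b : ChowGroup T.left 0, ∃ p q : ℤ, (p ≠ 0 ∨ q ≠ 0) ∧ p • a = q • b)
    (hCH' : ∀ a b : ChowGroup T'.left 0, ∃ p q : ℤ, (p ≠ 0 ∨ q ≠ 0) ∧ p • a = q • b) :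
    HodgeConjectureFor (3 + 3) (T ⊗ T') :=
  hodgeConjectureFor_tensor_threefolds_of_chowRankLEOneUpTo_zero hT hT'
    ((chowRankLEOneUpTo_iff_chowGroup T 0).2 fun j hj ↦ by obtain rfl : j = 0 := Nat.le_zero.mp hj; exact hCH)
    ((chowRankLEOneUpTo_iff_chowGroup T' 0).2 fun j hj ↦ by obtain rfl : j = 0 := Nat.le_zero.mp hj; exact hCH')

end Literature.AlgebraicGeometry.HodgeTheory

end
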